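import Mathlib.LinearAlgebra.Trace
import Mathlib.LinearAlgebra.TensorProduct.RightExactness
import Mathlib.LinearAlgebra.FreeModule.PID
import Mathlib.Algebra.Module.Torsion.Basic
import HarnessLib

/-!
# Trace after base change to a field = trace on the torsion-free quotient (Hatcher §2.C, "traces mod torsion")

Layer `Literature/Algebra/Homology` (pure linear algebra over Mathlib; proved theorems only, 0 definitions, 0 named facts, no instances,
no notation). LEAF A of the Hopf trace formula over `ℤ` (Hatcher, *Algebraic Topology*, §2.C after Thm. 2C.3: the Lefschetz number uses
"`tr(f_* : Hₙ(X) → Hₙ(X))`", computed on `Hₙ(X) ∕ torsion`; Spanier 4.7.6). The algebraic content isolated here: for a commutative domain `R`,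
an `R`-algebra `K` which is a FIELD with `algebraMap R K` injective (e.g. `ℤ ⊆ ℚ`, `R ⊆ Frac R`), an `R`-module `M` with torsion submodule
`T = Submodule.torsion R M` and an endomorphism `u : M →ₗ[R] M`:

* `torsion_le_comap` — `T` is `u`-stable, so `u` induces `ū = T.mapQ T u _ : M ⧸ T →ₗ[R] M ⧸ T` (Mathlib's `Submodule.mapQ`; no new object);
* `tmul_eq_zero_of_mem_torsion`, `lTensor_subtype_torsion_eq_zero` — `K ⊗_R T → K ⊗_R M` is zero (a non-zero `a ∈ R` becomes a unit in `K`);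
* `baseChange_mkQ_torsion_bijective` — **`K ⊗_R M → K ⊗_R (M ⧸ T)` is bijective** (right exactness of `K ⊗_R −`, Mathlib `lTensor_exact`, and the
  previous item), `baseChange_mapQ_comp` — it intertwines `u_K` and `ū_K`;
* **`trace_baseChange_eq_map_trace_mapQ`** — if `M ⧸ T` is finitely generated free (automatic for `M` finitely generated over a PID:
  Mathlib instances `Submodule.QuotientTorsion.instIsTorsionFree`, `Module.free_of_finite_type_torsion_free'`), then
  `tr_K(u_K : K ⊗_R M → K ⊗_R M) = algebraMap R K (tr_R(ū : M ⧸ T → M ⧸ T))` (Mathlib `LinearMap.trace_conj'` + `LinearMap.trace_baseChange` on the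
  free module `M ⧸ T`); `finrank_baseChange_eq_finrank_quotient_torsion` — `dim_K (K ⊗_R M) = rank_R (M ⧸ T)`; and the PID ∕ `ℤ` specialisations
  `trace_baseChange_eq_map_trace_mapQ_of_pid`, `Int.trace_baseChange_rat_eq`.

DEDUP (searched): Mathlib has `LinearMap.trace_baseChange` for FREE modules only and no statement about `K ⊗_R torsion = 0` as a trace ∕ quotient
identity; the tree's rows `HopfTraceFormulaBaseChange` ∕ `HomologyBaseChangeFlat` treat the free (torsion-free) case and say so; the Fuchs-lane file
`Algebra/Module/TensorProductTorsionFreeRankAndHeights` has the RANK statement `rank_quotient_torsion_eq_rank` (not used here). Library only (cell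
`pub-hodge-ring2`, count-neutral); proves nothing about any crux, route or conjecture.

## References

* A. Hatcher, *Algebraic Topology* (2002), §2.C, Thm. 2C.3 and the Hopf trace formula (traces on `Hₙ ∕ torsion`). [HatcherAT2002]
* E. H. Spanier, *Algebraic Topology* (1981), Ch. 4 §7, 6–7. [Spanier1981]
* K. S. Brown, *Cohomology of Groups* (1982), I §7 (ranks of `ℤG`-complexes after `ℚ ⊗ −`). [Brown1982]
-/

open TensorProduct

universe u v w

namespace Literature.Algebra.Homology.TraceBaseChangeTorsion

open Submodule (torsion)

variable {R : Type u} [CommRing R] {M : Type v} [AddCommGroup M] [Module R M]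

/-- The torsion submodule is stable under every endomorphism: `a • x = 0 ⇒ a • u x = 0`. [cite: HatcherAT2002, §2.C] -/
theorem torsion_le_comap (u : M →ₗ[R] M) : torsion R M ≤ (torsion R M).comap u := fun x hx => by
  obtain ⟨a, ha⟩ := (Submodule.mem_torsion_iff x).1 hx
  exact (Submodule.mem_torsion_iff (u x)).2 ⟨a, by rw [Submonoid.smul_def, ← map_smul, ← Submonoid.smul_def, ha, map_zero]⟩

variable [IsDomain R] (K : Type w) [Field K] [Algebra R K]

section Vanishing

variable (hK : Function.Injective (algebraMap R K))
include hK

/-- **`K ⊗_R (torsion) = 0`**: if `x` is a torsion element, `k ⊗ₜ x = 0` in `K ⊗_R M` (the annihilating `a ≠ 0` is a unit in `K`).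
[cite: HatcherAT2002, §2.C] -/
theorem tmul_eq_zero_of_mem_torsion (k : K) {x : M} (hx : x ∈ torsion R M) : k ⊗ₜ[R] x = 0 := by
  obtain ⟨a, ha⟩ := (Submodule.mem_torsion_iff x).1 hx
  have hane : algebraMap R K a ≠ 0 := (map_ne_zero_iff _ hK).2 (nonZeroDivisors.coe_ne_zero a)
  have ha' : (a : R) • x = 0 := ha
  calc k ⊗ₜ[R] x = ((a : R) • (k * (algebraMap R K a)⁻¹)) ⊗ₜ[R] x := by
        rw [Algebra.smul_def, mul_comm, inv_mul_cancel_right₀ hane]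
    _ = (k * (algebraMap R K a)⁻¹) ⊗ₜ[R] ((a : R) • x) := TensorProduct.smul_tmul _ _ _
    _ = 0 := by rw [ha', TensorProduct.tmul_zero]

/-- `K ⊗_R (T ↪ M) = 0` for the torsion submodule `T`. [cite: HatcherAT2002, §2.C] -/
theorem lTensor_subtype_torsion_eq_zero : LinearMap.lTensor K (torsion R M).subtype = 0 :=
  TensorProduct.ext' fun k t => by
    rw [LinearMap.lTensor_tmul, LinearMap.zero_apply]
    exact tmul_eq_zero_of_mem_torsion K hK k t.2

/-- **`K ⊗_R M → K ⊗_R (M ⧸ torsion)` is bijective** (surjective by right exactness; injective because its kernel is the image of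
`K ⊗_R torsion = 0`, Mathlib `lTensor_exact`). [cite: HatcherAT2002, §2.C] -/
theorem baseChange_mkQ_torsion_bijective : Function.Bijective ((torsion R M).mkQ.baseChange K) := by
  rw [LinearMap.baseChange_eq_ltensor]
  refine ⟨?_, LinearMap.lTensor_surjective K (Submodule.mkQ_surjective _)⟩
  rw [← LinearMap.ker_eq_bot, (lTensor_exact K (LinearMap.exact_subtype_mkQ (torsion R M)) (Submodule.mkQ_surjective _)).linearMap_ker_eq,
    lTensor_subtype_torsion_eq_zero K hK, LinearMap.range_zero]

end Vanishing

omit [IsDomain R] in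
/-- The base change of the projection intertwines `u_K` and `ū_K`: `ū_K ∘ π_K = π_K ∘ u_K`. [cite: HatcherAT2002, §2.C] -/
theorem baseChange_mapQ_comp (u : M →ₗ[R] M) :
    ((torsion R M).mapQ (torsion R M) u (torsion_le_comap u)).baseChange K ∘ₗ (torsion R M).mkQ.baseChange K =
      (torsion R M).mkQ.baseChange K ∘ₗ u.baseChange K := by
  rw [← LinearMap.baseChange_comp, ← LinearMap.baseChange_comp, Submodule.mapQ_mkQ]

variable (hK : Function.Injective (algebraMap R K))
include hK

/-- **Trace after base change to a field is the trace on the torsion-free quotient**: for `u : M →ₗ[R] M` with `M ⧸ torsion` finitely generated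
free, `tr_K(u_K) = algebraMap R K (tr_R(ū))`, `ū` the endomorphism of `M ⧸ torsion R M` induced by `u` (Hatcher's "trace mod torsion").
[cite: HatcherAT2002, Thm. 2C.3] [cite: Spanier1981, Ch. 4 §7] -/
theorem trace_baseChange_eq_map_trace_mapQ [Module.Free R (M ⧸ torsion R M)] [Module.Finite R (M ⧸ torsion R M)] (u : M →ₗ[R] M) :
    LinearMap.trace K (K ⊗[R] M) (u.baseChange K) =
      algebraMap R K (LinearMap.trace R (M ⧸ torsion R M) ((torsion R M).mapQ (torsion R M) u (torsion_le_comap u))) := by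
  let e : K ⊗[R] M ≃ₗ[K] K ⊗[R] (M ⧸ torsion R M) := LinearEquiv.ofBijective _ (baseChange_mkQ_torsion_bijective K hK)
  have hsq : ((torsion R M).mapQ (torsion R M) u (torsion_le_comap u)).baseChange K ∘ₗ e.toLinearMap = e.toLinearMap ∘ₗ u.baseChange K :=
    baseChange_mapQ_comp K u
  have hconj : e.conj (u.baseChange K) = ((torsion R M).mapQ (torsion R M) u (torsion_le_comap u)).baseChange K := by
    rw [LinearEquiv.conj_apply]
    exact ((LinearEquiv.eq_comp_toLinearMap_symm _ _).2 hsq).symm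
  rw [← LinearMap.trace_conj' (u.baseChange K) e, hconj, LinearMap.trace_baseChange]

/-- `dim_K (K ⊗_R M) = rank_R (M ⧸ torsion)` when `M ⧸ torsion` is finitely generated free. [cite: HatcherAT2002, §2.C] -/
theorem finrank_baseChange_eq_finrank_quotient_torsion [Module.Free R (M ⧸ torsion R M)] [Module.Finite R (M ⧸ torsion R M)] :
    Module.finrank K (K ⊗[R] M) = Module.finrank R (M ⧸ torsion R M) := by
  rw [(LinearEquiv.ofBijective _ (baseChange_mkQ_torsion_bijective K hK (M := M))).finrank_eq, Module.finrank_baseChange]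

/-- **PID form**: for `M` finitely generated over a principal ideal domain the quotient `M ⧸ torsion` is free automatically, so
`tr_K(u_K) = algebraMap R K (tr_R(ū))` for every endomorphism `u`. [cite: HatcherAT2002, Thm. 2C.3] -/
theorem trace_baseChange_eq_map_trace_mapQ_of_pid [IsPrincipalIdealRing R] [Module.Finite R M] (u : M →ₗ[R] M) :
    LinearMap.trace K (K ⊗[R] M) (u.baseChange K) =
      algebraMap R K (LinearMap.trace R (M ⧸ torsion R M) ((torsion R M).mapQ (torsion R M) u (torsion_le_comap u))) :=
  trace_baseChange_eq_map_trace_mapQ K hK u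

omit hK in
/-- **`ℤ ⊆ ℚ`**: for an endomorphism `u` of a finitely generated abelian group `M`, `tr_ℚ(u ⊗ ℚ) = tr_ℤ(ū : M∕torsion → M∕torsion)` (cast).
[cite: HatcherAT2002, Thm. 2C.3] [cite: Brown1982, I §7] -/
theorem Int.trace_baseChange_rat_eq {M : Type v} [AddCommGroup M] [Module.Finite ℤ M] (u : M →ₗ[ℤ] M) :
    LinearMap.trace ℚ (ℚ ⊗[ℤ] M) (u.baseChange ℚ) =
      (LinearMap.trace ℤ (M ⧸ torsion ℤ M) ((torsion ℤ M).mapQ (torsion ℤ M) u (torsion_le_comap u)) : ℚ) :=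
  trace_baseChange_eq_map_trace_mapQ ℚ (RingHom.injective_int _) u

end Literature.Algebra.Homology.TraceBaseChangeTorsion
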